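import Summits.BirchSwinnertonDyer.BirchSwinnertonDyer.Theorems.BiquadraticEisensteinDescentHeegnerTwistCouplingInSupplyHeavySparseDoor
import Summits.BirchSwinnertonDyer.BirchSwinnertonDyer.Theorems.BiquadraticEisensteinDescentHeegnerTwistCouplingInSupplySylvesterCorner
import Literature.NumberTheory.EllipticCurves.DeuringHeckeContinuationHolds
import HarnessLib

set_option linter.dupNamespace false -- `Summit.BirchSwinnertonDyer.BirchSwinnertonDyer.Theorems.…` (summit = sub, D-0017)
set_option autoImplicit false

/-!
# Crux `HeegnerTwistCouplingInSupply` (stmt-BirchSwinnertonDyer-21381), card `heavy-discriminant-sparsity` —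
# §D the card's INSTANCE: the Sylvester corner `W_p : y² + p·y = x³` (`p ≡ 8 (mod 9)`) in the bulk from a pure COUNT of
# `3`-descent certificates in the window `[−A·p², −1]` — no class-number bound `h_K < p`, no `L`-value in the hypothesis

Route `BiquadraticEisensteinDescent` (cell `pub/bsd-wall`; width seat `bsd-wall-cm-bed-w4` g29; THEOREMS ONLY,
`--supports 21381`). Fourth file of the unit «HEAVY-DISCRIMINANT SPARSITY + DENSITY DOOR». The kernel form of the Sylvester
corner (`…SylvesterCorner.lean`, w4 g26: `cruxConclusion_of_certificate`) turns ONE certificate `(K; a, b)` —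
`(d_K/3) = (d_K/p) = +1`, `3 ∤ h_K`, `a² + 3d_K b² = 4`, `p ∤ Im((a + b√(−3d_K))^{(p+1)/3})` — into the crux conclusion at
`(W_p, p)` PROVIDED `h_K < p` (the size lever, which confines `K` to `|d_K| ≲ p²/log²p`; the tables below `10⁵` use it).
The density door (§C, `cruxConclusion_of_window_density`) removes the proviso in the bulk: it suffices that the certified
discriminants have density `≥ δ` in a window `[−A·p², −1]`, because all but `o(A·p²)` of them are light (§B) and a light
certified `K` has `p ∤ h_K` by genus theory.

* `heegner_and_L_one_ne_zero_of_certificate` — the `L`-half of `SylvesterCorner.cruxConclusion_of_certificate` WITHOUT `h_K < p`: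
  a certificate gives `K` Heegner for `N(W_p)` and `L(W_p^{(d_K)}, 1) ≠ 0` (mod `hDesc`, `hBT`, `hH`);
* `card_certificates_le_card_nonvanishing` — in any window the certified `d` are among the non-vanishing Heegner `d`;
* ★★ `cruxOnSylvesterCorner_of_certificateDensity` — MODULO `hDesc` (3-descent, card `splitting-bias` L1), `hBT`, `hH`:
  if for some `A ≥ 1`, `δ > 0`, `p₁` every prime `p ≡ 8 (mod 9)`, `p ≥ p₁` has at least `δ·A·p²` certified `d ∈ [−A·p², −1]`
  (the card's Davenport–Heilbronn target: `3 ∤ h(d)`, `(d/3) = (d/p) = 1`, Lucas non-cube condition — a COUNT, uniform in `p`),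
  then there is `p₂` with the conclusion of crux 21381 at `(W_p, p)` for every prime `p ≡ 8 (mod 9)`, `p ≥ p₂`.

HONEST FRAMING: the certificate-density hypothesis is OPEN (card §INSTANCE: four Davenport–Heilbronn counts with one local
condition at `p`, floor `1/6`); `p₂` is ineffective; `hDesc` is not in the tree; the finitely many `p < p₂` stay with the
kernel tables (`…SylvesterCornerTable*`); C⁺, crux 21381 and BSD are NOT proved by any of this.
[cite: CohenPazuki2009, §2] [cite: BurungaleTian2026, Thm. 1.1] [cite: Cox2013, §3.B Thm. 3.15] [cite: GrossLMS1991, §1]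
-/

noncomputable section

open scoped Classical
open Finset
open WeierstrassCurve
open Literature.NumberTheory.EllipticCurves
open Summit.BirchSwinnertonDyer.BirchSwinnertonDyer.Theorems.SylvesterCorner

namespace Summit.BirchSwinnertonDyer.BirchSwinnertonDyer.Theorems.HeavyDiscriminant

/-! ## §D.1 The `L`-half of the certificate, without the size lever -/

/-- **A `3`-descent certificate gives a non-vanishing Heegner twist** (the `L`-half of `cruxConclusion_of_certificate`, with the
class-number bound `h_K < p` dropped): for a prime `p ≡ 8 (mod 9)`, `K` imaginary quadratic with `4 < |d_K|`,
`(d_K/3) = (d_K/p) = +1`, `3 ∤ h_K`, and `a² + 3 d_K b² = 4`, `p ∤ Im((a + b√(−3d_K))^{(p+1)/3})` — modulo `hDesc`, `hBT`, `hH` —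
`K` is Heegner for `N(W_p)` and `L(W_p^{(d_K)}, 1) ≠ 0`. [cite: CohenPazuki2009, §2] [cite: BurungaleTian2026, Thm. 1.1]
[cite: GrossLMS1991, §1] -/
theorem heegner_and_L_one_ne_zero_of_certificate
    (hDesc : ∀ (p : ℕ) (K : Type) [Field K] [NumberField K] (M a b : ℤ), p.Prime → p % 9 = 8 →
      IsImaginaryQuadratic K → 4 < (NumberField.discr K).natAbs →
      jacobiSym (NumberField.discr K) 3 = 1 → jacobiSym (NumberField.discr K) p = 1 →
      ¬ 3 ∣ NumberField.classNumber K → M = -3 * NumberField.discr K → a ^ 2 - M * b ^ 2 = 4 →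
      ¬ (p : ℤ) ∣ ((⟨a, b⟩ : ℤ√M) ^ ((p + 1) / 3)).im →
      ((⟨0, 0, (p : ℚ), 0, 0⟩ : WeierstrassCurve ℚ).quadraticTwist (NumberField.discr K : ℚ)).mordellWeilRank = 0 ∧
      ∀ c ∈ ((⟨0, 0, (p : ℚ), 0, 0⟩ : WeierstrassCurve ℚ).quadraticTwist (NumberField.discr K : ℚ)).sha,
        3 • c = 0 → c = 0)
    (hBT : burungaleTian_analyticRank_eq_zero_of_selmerCorank_eq_zero_of_hasCM)
    (hH : hasEntireLFunction_of_j_mem_maximalCMJInvariants)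
    {p : ℕ} (hp : p.Prime) (hp9 : p % 9 = 8) [(⟨0, 0, (p : ℚ), 0, 0⟩ : WeierstrassCurve ℚ).IsElliptic]
    (K : Type) [Field K] [NumberField K] (hK : IsImaginaryQuadratic K) (hd4 : 4 < (NumberField.discr K).natAbs)
    (hJ3 : jacobiSym (NumberField.discr K) 3 = 1) (hJp : jacobiSym (NumberField.discr K) p = 1)
    (hh3 : ¬ 3 ∣ NumberField.classNumber K)
    {M a b : ℤ} (hM : M = -3 * NumberField.discr K) (hab : a ^ 2 - M * b ^ 2 = 4)
    (hL : ¬ (p : ℤ) ∣ ((⟨a, b⟩ : ℤ√M) ^ ((p + 1) / 3)).im) :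
    SatisfiesHeegnerHypothesis ((⟨0, 0, (p : ℚ), 0, 0⟩ : WeierstrassCurve ℚ).conductorNorm ℤ) K ∧
      ((⟨0, 0, (p : ℚ), 0, 0⟩ : WeierstrassCurve ℚ).quadraticTwist (NumberField.discr K : ℚ)).entireLFunction 1 ≠ 0 := by
  have hp2 : p ≠ 2 := by rintro rfl; omega
  have hp0 : p ≠ 0 := hp.ne_zero
  have hHeeg : SatisfiesHeegnerHypothesis ((⟨0, 0, (p : ℚ), 0, 0⟩ : WeierstrassCurve ℚ).conductorNorm ℤ) K :=
    satisfiesHeegnerHypothesis_of_three_p hK.1 hp2 hJ3 hJp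
      (fun r hr hrN => eq_three_or_eq_of_prime_dvd_conductorNorm_W hp hr hrN)
  have hd0 : (NumberField.discr K : ℚ) ≠ 0 := by
    have : NumberField.discr K ≠ 0 := by
      intro h
      rw [h] at hd4
      simp at hd4
    exact_mod_cast this
  obtain ⟨hE, hj, -⟩ := isElliptic_j_hasCM_twist hp0 hd0
  obtain ⟨hrank, hsha⟩ := hDesc p K M a b hp hp9 hK hd4 hJ3 hJp hh3 hM hab hL
  exact ⟨hHeeg, (L_one_ne_zero_of_desc hBT hH _ hj hrank hsha).2⟩

/-! ## §D.2 Certified discriminants are non-vanishing Heegner discriminants -/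

/-- **In any window, the certified `d` are among the non-vanishing Heegner `d` of `N(W_p)`** (modulo `hDesc`, `hBT`, `hH`):
`#{d ∈ [−X,−1] certified} ≤ #{d ∈ [−X,−1] : ∃ K Heegner for N(W_p), d_K = d, |d| > 4, L(W_p^{(d)}, 1) ≠ 0}`.
[cite: CohenPazuki2009, §2] [cite: BurungaleTian2026, Thm. 1.1] -/
theorem card_certificates_le_card_nonvanishing
    (hDesc : ∀ (p : ℕ) (K : Type) [Field K] [NumberField K] (M a b : ℤ), p.Prime → p % 9 = 8 →
      IsImaginaryQuadratic K → 4 < (NumberField.discr K).natAbs →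
      jacobiSym (NumberField.discr K) 3 = 1 → jacobiSym (NumberField.discr K) p = 1 →
      ¬ 3 ∣ NumberField.classNumber K → M = -3 * NumberField.discr K → a ^ 2 - M * b ^ 2 = 4 →
      ¬ (p : ℤ) ∣ ((⟨a, b⟩ : ℤ√M) ^ ((p + 1) / 3)).im →
      ((⟨0, 0, (p : ℚ), 0, 0⟩ : WeierstrassCurve ℚ).quadraticTwist (NumberField.discr K : ℚ)).mordellWeilRank = 0 ∧
      ∀ c ∈ ((⟨0, 0, (p : ℚ), 0, 0⟩ : WeierstrassCurve ℚ).quadraticTwist (NumberField.discr K : ℚ)).sha,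
        3 • c = 0 → c = 0)
    (hBT : burungaleTian_analyticRank_eq_zero_of_selmerCorank_eq_zero_of_hasCM)
    (hH : hasEntireLFunction_of_j_mem_maximalCMJInvariants)
    {p : ℕ} (hp : p.Prime) (hp9 : p % 9 = 8) [(⟨0, 0, (p : ℚ), 0, 0⟩ : WeierstrassCurve ℚ).IsElliptic] (X : ℕ) :
    ((Icc (-(X : ℤ)) (-1)).filter (fun d ↦
        ∃ (K : Type) (_ : Field K) (_ : NumberField K), IsImaginaryQuadratic K ∧ NumberField.discr K = d ∧
          4 < d.natAbs ∧ jacobiSym d 3 = 1 ∧ jacobiSym d p = 1 ∧ ¬ 3 ∣ NumberField.classNumber K ∧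
          ∃ a b : ℤ, a ^ 2 - (-3 * d) * b ^ 2 = 4 ∧
            ¬ (p : ℤ) ∣ ((⟨a, b⟩ : ℤ√(-3 * d)) ^ ((p + 1) / 3)).im)).card ≤
    ((Icc (-(X : ℤ)) (-1)).filter (fun d ↦
        ∃ (K : Type) (_ : Field K) (_ : NumberField K), IsImaginaryQuadratic K ∧ NumberField.discr K = d ∧
          4 < d.natAbs ∧ SatisfiesHeegnerHypothesis ((⟨0, 0, (p : ℚ), 0, 0⟩ : WeierstrassCurve ℚ).conductorNorm ℤ) K ∧
          ((⟨0, 0, (p : ℚ), 0, 0⟩ : WeierstrassCurve ℚ).quadraticTwist (d : ℚ)).entireLFunction 1 ≠ 0)).card := by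
  refine card_le_card (fun d hd ↦ ?_)
  rw [mem_filter] at hd ⊢
  obtain ⟨hdI, K, iF, iN, hK, hdisc, h4, hJ3, hJp, hh3, a, b, hab, hL⟩ := hd
  refine ⟨hdI, K, iF, iN, hK, hdisc, h4, ?_⟩
  subst hdisc
  exact heegner_and_L_one_ne_zero_of_certificate hDesc hBT hH hp hp9 K hK h4 hJ3 hJp hh3 rfl hab hL

/-! ## §D.3 ★★ The Sylvester corner in the bulk from certificate density -/

/-- ★★ **The Sylvester corner in the bulk from a COUNT of certificates** (the card's INSTANCE with the class-number side
discharged). MODULO `hDesc` (the `3`-isogeny descent, card `splitting-bias` L1 in Lucas form), Burungale–Tian `hBT` and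
Deuring–Hecke `hH`: if for some `A ≥ 1`, `δ > 0` and `p₁`, every prime `p ≡ 8 (mod 9)` with `p ≥ p₁` admits at least `δ·A·p²`
integers `d ∈ [−A·p², −1]` that are discriminants of imaginary quadratic `K` with `|d| > 4`, `(d/3) = (d/p) = 1`, `3 ∤ h_K` and a
Lucas certificate `a² + 3d b² = 4`, `p ∤ Im((a + b√(−3d))^{(p+1)/3})`, then for some `p₂` and every prime `p ≡ 8 (mod 9)`,
`p ≥ p₂`, the conclusion of `HeegnerTwistCouplingInSupply` holds at `(W_p, p)`: an imaginary quadratic Heegner field `K′` of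
`N(W_p)` with `|d_{K′}| > 4`, `L(W_p^{(d_{K′})}, 1) ≠ 0` and `p ∤ h(K′)`. No hypothesis `h_{K′} < p`; `p ∤ h` comes from the
heavy-sparsity theorem and genus theory (§B, §C). [cite: CohenPazuki2009, §2] [cite: BurungaleTian2026, Thm. 1.1]
[cite: Cox2013, §3.B Thm. 3.15] [cite: GrossLMS1991, §1] -/
theorem cruxOnSylvesterCorner_of_certificateDensity
    (hDesc : ∀ (p : ℕ) (K : Type) [Field K] [NumberField K] (M a b : ℤ), p.Prime → p % 9 = 8 →
      IsImaginaryQuadratic K → 4 < (NumberField.discr K).natAbs →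
      jacobiSym (NumberField.discr K) 3 = 1 → jacobiSym (NumberField.discr K) p = 1 →
      ¬ 3 ∣ NumberField.classNumber K → M = -3 * NumberField.discr K → a ^ 2 - M * b ^ 2 = 4 →
      ¬ (p : ℤ) ∣ ((⟨a, b⟩ : ℤ√M) ^ ((p + 1) / 3)).im →
      ((⟨0, 0, (p : ℚ), 0, 0⟩ : WeierstrassCurve ℚ).quadraticTwist (NumberField.discr K : ℚ)).mordellWeilRank = 0 ∧
      ∀ c ∈ ((⟨0, 0, (p : ℚ), 0, 0⟩ : WeierstrassCurve ℚ).quadraticTwist (NumberField.discr K : ℚ)).sha,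
        3 • c = 0 → c = 0)
    (hBT : burungaleTian_analyticRank_eq_zero_of_selmerCorank_eq_zero_of_hasCM)
    (hH : hasEntireLFunction_of_j_mem_maximalCMJInvariants)
    (hCD : ∃ (A : ℕ) (δ : ℝ) (p₁ : ℕ), 1 ≤ A ∧ 0 < δ ∧ ∀ p : ℕ, p.Prime → p % 9 = 8 → p₁ ≤ p →
      δ * ((A * p ^ 2 : ℕ) : ℝ) ≤ (((Icc (-((A * p ^ 2 : ℕ) : ℤ)) (-1)).filter (fun d ↦
        ∃ (K : Type) (_ : Field K) (_ : NumberField K), IsImaginaryQuadratic K ∧ NumberField.discr K = d ∧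
          4 < d.natAbs ∧ jacobiSym d 3 = 1 ∧ jacobiSym d p = 1 ∧ ¬ 3 ∣ NumberField.classNumber K ∧
          ∃ a b : ℤ, a ^ 2 - (-3 * d) * b ^ 2 = 4 ∧
            ¬ (p : ℤ) ∣ ((⟨a, b⟩ : ℤ√(-3 * d)) ^ ((p + 1) / 3)).im)).card : ℝ)) :
    ∃ p₂ : ℕ, ∀ p : ℕ, p.Prime → p % 9 = 8 → p₂ ≤ p →
      ∃ (K : Type) (_ : Field K) (_ : NumberField K),
        IsImaginaryQuadratic K ∧ 4 < (NumberField.discr K).natAbs ∧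
          SatisfiesHeegnerHypothesis ((⟨0, 0, (p : ℚ), 0, 0⟩ : WeierstrassCurve ℚ).conductorNorm ℤ) K ∧
          ((⟨0, 0, (p : ℚ), 0, 0⟩ : WeierstrassCurve ℚ).quadraticTwist (NumberField.discr K : ℚ)).entireLFunction 1 ≠ 0 ∧
          ¬ p ∣ NumberField.classNumber K := by
  obtain ⟨A, δ, p₁, hA, hδ, hCD⟩ := hCD
  obtain ⟨p₂, hp₂⟩ := cruxConclusion_of_window_density A δ hA hδ
  refine ⟨max p₁ p₂, fun p hp hp9 hle ↦ ?_⟩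
  haveI := isElliptic_sylvester hp.ne_zero
  have hp2 : p ≠ 2 := by rintro rfl; omega
  refine hp₂ (⟨0, 0, (p : ℚ), 0, 0⟩ : WeierstrassCurve ℚ) p hp hp2 (le_trans (le_max_right _ _) hle) ?_
  refine (hCD p hp hp9 (le_trans (le_max_left _ _) hle)).trans ?_
  exact_mod_cast card_certificates_le_card_nonvanishing hDesc hBT hH hp hp9 (A * p ^ 2)

/-! ## §D.4 The same with the Deuring–Hecke leaf DISCHARGED (appended) -/

/-- ★★ **The Sylvester corner in the bulk from a count of certificates, modulo `hDesc` and Burungale–Tian ONLY**: the Deuring–Hecke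
continuation hypothesis `hH` of `cruxOnSylvesterCorner_of_certificateDensity` is the tree THEOREM
`DeuringHecke.hasEntireLFunction_of_j_mem_maximalCMJInvariants_holds` (Hecke theta series of the nine class-number-one orders), so it
is discharged here. [cite: CohenPazuki2009, §2] [cite: BurungaleTian2026, Thm. 1.1] [cite: SilvermanATAEC1994, II Cor. 10.5.1] -/
theorem cruxOnSylvesterCorner_of_certificateDensity_of_BT
    (hDesc : ∀ (p : ℕ) (K : Type) [Field K] [NumberField K] (M a b : ℤ), p.Prime → p % 9 = 8 →
      IsImaginaryQuadratic K → 4 < (NumberField.discr K).natAbs →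
      jacobiSym (NumberField.discr K) 3 = 1 → jacobiSym (NumberField.discr K) p = 1 →
      ¬ 3 ∣ NumberField.classNumber K → M = -3 * NumberField.discr K → a ^ 2 - M * b ^ 2 = 4 →
      ¬ (p : ℤ) ∣ ((⟨a, b⟩ : ℤ√M) ^ ((p + 1) / 3)).im →
      ((⟨0, 0, (p : ℚ), 0, 0⟩ : WeierstrassCurve ℚ).quadraticTwist (NumberField.discr K : ℚ)).mordellWeilRank = 0 ∧
      ∀ c ∈ ((⟨0, 0, (p : ℚ), 0, 0⟩ : WeierstrassCurve ℚ).quadraticTwist (NumberField.discr K : ℚ)).sha,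
        3 • c = 0 → c = 0)
    (hBT : burungaleTian_analyticRank_eq_zero_of_selmerCorank_eq_zero_of_hasCM)
    (hCD : ∃ (A : ℕ) (δ : ℝ) (p₁ : ℕ), 1 ≤ A ∧ 0 < δ ∧ ∀ p : ℕ, p.Prime → p % 9 = 8 → p₁ ≤ p →
      δ * ((A * p ^ 2 : ℕ) : ℝ) ≤ (((Icc (-((A * p ^ 2 : ℕ) : ℤ)) (-1)).filter (fun d ↦
        ∃ (K : Type) (_ : Field K) (_ : NumberField K), IsImaginaryQuadratic K ∧ NumberField.discr K = d ∧
          4 < d.natAbs ∧ jacobiSym d 3 = 1 ∧ jacobiSym d p = 1 ∧ ¬ 3 ∣ NumberField.classNumber K ∧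
          ∃ a b : ℤ, a ^ 2 - (-3 * d) * b ^ 2 = 4 ∧
            ¬ (p : ℤ) ∣ ((⟨a, b⟩ : ℤ√(-3 * d)) ^ ((p + 1) / 3)).im)).card : ℝ)) :
    ∃ p₂ : ℕ, ∀ p : ℕ, p.Prime → p % 9 = 8 → p₂ ≤ p →
      ∃ (K : Type) (_ : Field K) (_ : NumberField K),
        IsImaginaryQuadratic K ∧ 4 < (NumberField.discr K).natAbs ∧
          SatisfiesHeegnerHypothesis ((⟨0, 0, (p : ℚ), 0, 0⟩ : WeierstrassCurve ℚ).conductorNorm ℤ) K ∧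
          ((⟨0, 0, (p : ℚ), 0, 0⟩ : WeierstrassCurve ℚ).quadraticTwist (NumberField.discr K : ℚ)).entireLFunction 1 ≠ 0 ∧
          ¬ p ∣ NumberField.classNumber K :=
  cruxOnSylvesterCorner_of_certificateDensity hDesc hBT DeuringHecke.hasEntireLFunction_of_j_mem_maximalCMJInvariants_holds hCD

end Summit.BirchSwinnertonDyer.BirchSwinnertonDyer.Theorems.HeavyDiscriminant

end
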